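import Summits.KontsevichZagierPeriods.KontsevichZagierPeriods.Theses.StandardParts
import Summits.KontsevichZagierPeriods.KontsevichZagierPeriods.Theorems.StandardPartsSpArcLiftingRawArcs
import Literature.NumberTheory.Transcendental.KZTameMoveFamily
import Literature.NumberTheory.Transcendental.KZVolumeConjectureProofs
import Literature.NumberTheory.Transcendental.KZKernelConjectureForms

/-!
# `SpArcLiftingOfPieces` (stmt-KontsevichZagierPeriods-18037, route StandardParts) — proof

Closes the support item `SpArcLiftingOfPieces : SpVolumeArcLifting → SpTameNoBlowUp →
SpTameUniformClosure → SpArcLifting` — the assembly of the crux-strategist's BC2-redirect split of the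
deciding crux `SpArcLifting` (stmt-3155, summit-equivalent as typed) into the three leaves stmt-18034
`SpVolumeArcLifting` (arithmetic half on Cresson–Viu-Sos' compact volume forms), stmt-18035 `SpTameNoBlowUp`
(tame arcs of identities are uniform near `0⁺`) and stmt-18036 `SpTameUniformClosure` (tame uniform chains
pass to the `L¹`-limit). The planner's published sorry-free proof (`Cruxes/SpArcLifting/SplitGlue.lean`,
`spArcLifting_of_pieces`; `Cruxes/SpArcLifting/GlueClose.lean`) re-homed under `Theorems/` by lead c10 of
crux stmt-9129 (line Sketch, banking).

Proof: the pieces give the volume form of Conjecture 1 (lift the equal-volume pair of compact bodies to a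
tame arc of identities by X₁, make it one tame uniform chain on some `(0, δ)` by X₂, close at the
`L¹`-endpoints by X₃ — tameness bounds merged by `RawFamily.IsTame.mono` / `TameUniformChainOn.mono`); the volume form gives `KZPeriodConjecture'` by Viu-Sos' semi-canonical
reduction, DISCHARGED in the tree (`KZ.kzPeriodConjecture'_of_volumeConjectureCompact`,
`KZ.semiCanonicalReduction_holds`); that gives the summit (`kzPeriodConjecture'_iff_isRational`), which
gives `SpArcLifting` by constant typed arcs (`spArcLifting_of_summit`).

Sources: M. Kontsevich, D. Zagier, *Periods* (2001), §1.2 Conjecture 1 [KontsevichZagier2001];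
J. Viu-Sos, IJNT 17 (2021), Thm. 1.1 [ViuSos2021]; J. Cresson, J. Viu-Sos, JTNB 34 (2022), §1 p. 326
[CressonViusos2022].
-/

noncomputable section

namespace Summit.KontsevichZagierPeriods.StandardParts

open Filter Set MeasureTheory Topology
open Literature.NumberTheory.Transcendental

/-- **`SpArcLiftingOfPieces`** (route StandardParts, stmt-KontsevichZagierPeriods-18037): the split glue
`SpVolumeArcLifting → SpTameNoBlowUp → SpTameUniformClosure → SpArcLifting` — if equal-volume compact
bodies lift to tame arcs of identities, tame arcs of identities are uniform near `0⁺`, and tame uniform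
chains pass to `L¹`-limits, then every equal-valued pair of KZ-rational representations is the pair of
`L¹`-endpoints of `ℚ`-semialgebraic arcs of identities. Proof: the pieces give the volume form of
Conjecture 1 (lift by X₁, uniformise by X₂, close by X₃, tameness bounds merged by `RawFamily.IsTame.mono` /
`TameUniformChainOn.mono`), the volume form gives the summit through Viu-Sos' discharged semi-canonical
reduction (`KZ.kzPeriodConjecture'_of_volumeConjectureCompact`, `KZ.semiCanonicalReduction_holds`,
`kzPeriodConjecture'_iff_isRational`), and the summit gives `SpArcLifting` by constant typed arcs
(`spArcLifting_of_summit`); the planner's published split-glue proof `spArcLifting_of_pieces` re-homed.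
[cite: KontsevichZagier2001, §1.2 Conjecture 1] [cite: CressonViusos2022, §1 p. 326]
[cite: ViuSos2021, Thm. 1.1] [folklore] -/
theorem spArcLiftingOfPieces_proof :
    Summit.KontsevichZagierPeriods.KontsevichZagierPeriods.Theses.StandardParts.SpArcLiftingOfPieces := by
  intro h₁ h₂ h₃
  -- (1) the three leaves give the volume form of Conjecture 1: lift, uniformise, close
  have hvol : KZ.volumeConjectureCompact := by
    intro d K K' hc hi hc' hi' h1 h1' hv
    obtain ⟨N, S, S', hS, hS', hid, hl, hl'⟩ := h₁ K K' hc hi hc' hi' h1 h1' hv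
    obtain ⟨N', δ, hδ, huc⟩ := h₂ N S S' hS hS' hid
    exact h₃ (max N N') δ S S' K K' hδ (hS.mono (le_max_left N N')) (hS'.mono (le_max_left N N'))
      (huc.mono subset_rfl (le_max_right N N')) hl hl'
  -- (2) volume form ⇒ `KZPeriodConjecture'` (Viu-Sos' reduction, discharged in the tree) ⇒ the summit
  have hsummit : KontsevichZagierPeriods :=
    kzPeriodConjecture'_iff_isRational.mp
      (KZ.kzPeriodConjecture'_of_volumeConjectureCompact KZ.semiCanonicalReduction_holds hvol)
  -- (3) the summit ⇒ `SpArcLifting` by constant typed arcs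
  exact spArcLifting_of_summit hsummit

end Summit.KontsevichZagierPeriods.StandardParts

end
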